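import Mathlib
import HarnessLib

/-!
# Inner product integration rules (IPIR)
# (Davis–Rabinowitz 1984, Sect. 2.5.4, (2.5.4.1)–(2.5.4.4) and the example of Duris)

**Source.** P. J. Davis, P. Rabinowitz, *Methods of Numerical Integration* (2nd ed., Academic Press, 1984),
Sect. 2.5.4 "Inner Product Integration Rules" (held OCR PDF pp. 75–77).

**The text.** To integrate a product `f = g h` whose factors behave differently one uses an *inner product
integration rule* `∫_a^b w g h ≈ Σ_{i=0}^m Σ_{j=0}^n a_ij g(x_i) h(y_j) = gᵀ A h` (2.5.4.1). It is *symmetric* if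
`m = n`, `x_i = y_i`, `A = Aᵀ`; if `A = diag(w_0, …, w_m)` the symmetric IPIR "reduces to an ordinary integration
rule". The *interpolatory* IPIR has `a_ij = ∫_a^b w l_i L_j` (2.5.4.2) with the fundamental Lagrange polynomials
`l_i`, `L_j` of the two node sets (2.5.4.3); it is exact for all `f = g h` of joint degree `(m, n)` (`g ∈ 𝒫_m`,
`h ∈ 𝒫_n`), and for `m = n`, `w ≥ 0`, it cannot be exact for joint degree `(m + 1 + l, m + 1 − l)` (take `f = π²`).
For `w = 1` an IPIR is shifted to `[c, d]` by the factor `(d − c)/(b − a)` (2.5.4.4). Example (Duris):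
`I = ∫_0^{2π} x sin 20x cos 50x dx = 2π/105 = .05983986`, treated with the IPIR "corresponding to Simpson's rule over
`[0, 1]`", `Q(f, g) = (f(0), f(½), f(1)) A (g(0), g(½), g(1))ᵀ` with the printed matrix `A = (1/15)[[4, 2, −1], [2, 16, 2],
[−1, 2, 4]]`.

**What is typed** (all PROVED, Mathlib only):
* `ipir A x y g h = Σ_i Σ_j A i j · g(x_i) · h(y_j)` (2.5.4.1); `ipir_diagonal` — a diagonal `A` gives the ordinary
  rule `Σ w_i g(x_i) h(x_i)` applied to the product; `ipir_transpose` — symmetry `A = Aᵀ` ⇔ `Q(g, h) = Q(h, g)` form.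
* The interpolatory IPIR on the Simpson nodes `0, ½, 1` of `[0, 1]`, `w = 1`: the Lagrange polynomials
  `l₀ = 2(x − ½)(x − 1)`, `l₁ = −4x(x − 1)`, `l₂ = 2x(x − ½)` (`simpsonLagrange`), the entries
  `a_ij = ∫_0^1 l_i l_j` (2.5.4.2) computed exactly (`integral_simpsonLagrange_mul`): the matrix is
  `simpsonIPIRMatrix = (1/30)[[4, 2, −1], [2, 16, 2], [−1, 2, 4]]`. CHECK ON THE PRINTED CONSTANT: the entries of an
  interpolatory IPIR with `w = 1` on `[a, b]` sum to `b − a` (`g = h = 1` is of joint degree `(0, 0)`); for `[0, 1]`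
  this forces the factor `1/30` (`simpsonIPIRMatrix_sum = 1`), so the printed `1/15` is the matrix of the interval
  `[−1, 1]` (or `[0, 2]`) via (2.5.4.4) (`simpsonIPIRMatrix_interval_two_sum = 2`), not of `[0, 1]` as stated.
* `ipir_simpson_exact_joint22` — exactness for joint degree `(2, 2)`: for all quadratics `g`, `h`,
  `gᵀ A h = ∫_0^1 g h`; `ipir_simpson_not_exact_pi_sq` — the book's non-exactness witness for `m = n = 2`, `l = 0`:
  with `π(x) = x(x − ½)(x − 1)`, `g = h = π` (joint degree `(3, 3)`) the rule gives `0` while `∫_0^1 π² = 1/840 > 0`.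
* The example's exact value: `∫_0^{2π} x sin(k x) dx = −2π/k` for a nonzero integer `k` (`integral_x_mul_sin_int`),
  the product-to-sum step `x sin 20x cos 50x = (x sin 70x − x sin 30x)/2`, and `I = 2π/105` (`duris_integral`).

References: [cite: DavisRabinowitz1984, Sect. 2.5.4 (2.5.4.1)-(2.5.4.4)].
-/

noncomputable section

open Finset Real MeasureTheory intervalIntegral

namespace Literature.Analysis.Quadrature

/-! ## (2.5.4.1) -/

/-- The inner product integration rule `gᵀ A h = Σ_i Σ_j a_ij g(x_i) h(y_j)` (2.5.4.1).
[cite: DavisRabinowitz1984, Sect. 2.5.4 (2.5.4.1)] -/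
def ipir {m n : ℕ} (A : Fin m → Fin n → ℝ) (x : Fin m → ℝ) (y : Fin n → ℝ) (g h : ℝ → ℝ) : ℝ :=
  ∑ i, ∑ j, A i j * g (x i) * h (y j)

/-- A diagonal matrix `A = diag(w)` turns the (symmetric) IPIR into the ordinary rule `Σ w_i (g h)(x_i)`.
[cite: DavisRabinowitz1984, Sect. 2.5.4 (2.5.4.1)] -/
theorem ipir_diagonal {m : ℕ} (w x : Fin m → ℝ) (g h : ℝ → ℝ) :
    ipir (fun i j => if i = j then w i else 0) x x g h = ∑ i, w i * (g (x i) * h (x i)) := by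
  unfold ipir
  refine sum_congr rfl fun i _ => ?_
  rw [sum_eq_single i]
  · simp [mul_assoc]
  · intro j _ hj; simp [Ne.symm hj]
  · intro hi; exact absurd (mem_univ i) hi

/-- Transposing `A` and swapping the node sets swaps the roles of `g` and `h`; hence a symmetric IPIR
(`x = y`, `A = Aᵀ`) satisfies `Q(g, h) = Q(h, g)`. [cite: DavisRabinowitz1984, Sect. 2.5.4 (2.5.4.1)] -/
theorem ipir_transpose {m n : ℕ} (A : Fin m → Fin n → ℝ) (x : Fin m → ℝ) (y : Fin n → ℝ) (g h : ℝ → ℝ) :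
    ipir (fun j i => A i j) y x h g = ipir A x y g h := by
  unfold ipir
  rw [sum_comm]
  exact sum_congr rfl fun i _ => sum_congr rfl fun j _ => by ring

/-- A symmetric IPIR is symmetric in `(g, h)`. [cite: DavisRabinowitz1984, Sect. 2.5.4 (2.5.4.1)] -/
theorem ipir_symm_of_symmetric {m : ℕ} (A : Fin m → Fin m → ℝ) (hA : ∀ i j, A i j = A j i) (x : Fin m → ℝ)
    (g h : ℝ → ℝ) : ipir A x x h g = ipir A x x g h := by
  rw [← ipir_transpose A x x g h]
  unfold ipir
  exact sum_congr rfl fun i _ => sum_congr rfl fun j _ => by rw [hA]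

/-! ## The interpolatory IPIR on the Simpson nodes of `[0, 1]` -/

/-- The Simpson nodes `0, ½, 1`. [cite: DavisRabinowitz1984, Sect. 2.5.4 (2.5.4.3)] -/
def simpsonNodes : Fin 3 → ℝ := ![0, 1 / 2, 1]

/-- The fundamental Lagrange polynomials of the nodes `0, ½, 1` (2.5.4.3):
`l₀ = 2(x − ½)(x − 1)`, `l₁ = −4x(x − 1)`, `l₂ = 2x(x − ½)`. [cite: DavisRabinowitz1984, Sect. 2.5.4 (2.5.4.3)] -/
def simpsonLagrange : Fin 3 → ℝ → ℝ :=
  ![fun x => 2 * (x - 1 / 2) * (x - 1), fun x => -4 * x * (x - 1), fun x => 2 * x * (x - 1 / 2)]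

/-- `l_i(x_k) = δ_ik`. [cite: DavisRabinowitz1984, Sect. 2.5.4 (2.5.4.3)] -/
theorem simpsonLagrange_nodes (i k : Fin 3) :
    simpsonLagrange i (simpsonNodes k) = if i = k then 1 else 0 := by
  fin_cases i <;> fin_cases k <;> simp [simpsonLagrange, simpsonNodes] <;> norm_num

/-- A quadratic is reproduced by Lagrange interpolation at `0, ½, 1`.
[cite: DavisRabinowitz1984, Sect. 2.5.4 (2.5.4.3)] -/
theorem quadratic_eq_sum_simpsonLagrange (p₀ p₁ p₂ x : ℝ) :
    p₀ + p₁ * x + p₂ * x ^ 2 =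
      ∑ i, (p₀ + p₁ * simpsonNodes i + p₂ * simpsonNodes i ^ 2) * simpsonLagrange i x := by
  simp [Fin.sum_univ_three, simpsonLagrange, simpsonNodes]
  ring

/-- `∫_0^1` of a quartic. [cite: DavisRabinowitz1984, Sect. 2.5.4 (2.5.4.2)] -/
theorem integral_quartic_zero_one (c₀ c₁ c₂ c₃ c₄ : ℝ) :
    ∫ x in (0 : ℝ)..1, (c₀ + c₁ * x + c₂ * x ^ 2 + c₃ * x ^ 3 + c₄ * x ^ 4) =
      c₀ + c₁ / 2 + c₂ / 3 + c₃ / 4 + c₄ / 5 := by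
  have h1 : ∫ x in (0 : ℝ)..1, x = 1 / 2 := by rw [integral_id]; norm_num
  have h2 : ∫ x in (0 : ℝ)..1, x ^ 2 = 1 / 3 := by rw [integral_pow]; norm_num
  have h3 : ∫ x in (0 : ℝ)..1, x ^ 3 = 1 / 4 := by rw [integral_pow]; norm_num
  have h4 : ∫ x in (0 : ℝ)..1, x ^ 4 = 1 / 5 := by rw [integral_pow]; norm_num
  have e1 : ∫ x in (0 : ℝ)..1, (c₀ + c₁ * x + c₂ * x ^ 2 + c₃ * x ^ 3 + c₄ * x ^ 4) =
      (∫ x in (0 : ℝ)..1, (c₀ + c₁ * x + c₂ * x ^ 2 + c₃ * x ^ 3)) + ∫ x in (0 : ℝ)..1, c₄ * x ^ 4 :=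
    integral_add (Continuous.intervalIntegrable (by fun_prop) _ _) (Continuous.intervalIntegrable (by fun_prop) _ _)
  have e2 : ∫ x in (0 : ℝ)..1, (c₀ + c₁ * x + c₂ * x ^ 2 + c₃ * x ^ 3) =
      (∫ x in (0 : ℝ)..1, (c₀ + c₁ * x + c₂ * x ^ 2)) + ∫ x in (0 : ℝ)..1, c₃ * x ^ 3 :=
    integral_add (Continuous.intervalIntegrable (by fun_prop) _ _) (Continuous.intervalIntegrable (by fun_prop) _ _)
  have e3 : ∫ x in (0 : ℝ)..1, (c₀ + c₁ * x + c₂ * x ^ 2) =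
      (∫ x in (0 : ℝ)..1, (c₀ + c₁ * x)) + ∫ x in (0 : ℝ)..1, c₂ * x ^ 2 :=
    integral_add (Continuous.intervalIntegrable (by fun_prop) _ _) (Continuous.intervalIntegrable (by fun_prop) _ _)
  have e4 : ∫ x in (0 : ℝ)..1, (c₀ + c₁ * x) = (∫ x in (0 : ℝ)..1, c₀) + ∫ x in (0 : ℝ)..1, c₁ * x :=
    integral_add (Continuous.intervalIntegrable (by fun_prop) _ _) (Continuous.intervalIntegrable (by fun_prop) _ _)
  rw [e1, e2, e3, e4, intervalIntegral.integral_const_mul, intervalIntegral.integral_const_mul,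
    intervalIntegral.integral_const_mul, intervalIntegral.integral_const_mul, h1, h2, h3, h4, intervalIntegral.integral_const]
  simp
  ring

/-- The interpolatory IPIR matrix (2.5.4.2) of the Simpson nodes on `[0, 1]`, `w = 1`:
`(1/30)[[4, 2, −1], [2, 16, 2], [−1, 2, 4]]`. [cite: DavisRabinowitz1984, Sect. 2.5.4 (2.5.4.2)] -/
def simpsonIPIRMatrix : Fin 3 → Fin 3 → ℝ :=
  fun i j => (1 / 30 : ℝ) * (![![4, 2, -1], ![2, 16, 2], ![-1, 2, 4]] : Fin 3 → Fin 3 → ℝ) i j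

/-- Coefficient table of the products `l_i l_j = Σ_{k<5} c_ijk x^k`.
[cite: DavisRabinowitz1984, Sect. 2.5.4 (2.5.4.2)] -/
def simpsonLagrangeProdCoeff : Fin 3 → Fin 3 → Fin 5 → ℝ :=
  ![![![1, -6, 13, -12, 4], ![0, 4, -16, 20, -8], ![0, -1, 5, -8, 4]],
    ![![0, 4, -16, 20, -8], ![0, 0, 16, -32, 16], ![0, 0, -4, 12, -8]],
    ![![0, -1, 5, -8, 4], ![0, 0, -4, 12, -8], ![0, 0, 1, -4, 4]]]

/-- The products of the Lagrange polynomials as explicit quartics.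
[cite: DavisRabinowitz1984, Sect. 2.5.4 (2.5.4.2)] -/
theorem simpsonLagrange_mul (i j : Fin 3) (x : ℝ) :
    simpsonLagrange i x * simpsonLagrange j x = ∑ k : Fin 5, simpsonLagrangeProdCoeff i j k * x ^ (k : ℕ) := by
  fin_cases i <;> fin_cases j <;> simp [simpsonLagrange, simpsonLagrangeProdCoeff, Fin.sum_univ_five] <;> ring

/-- `∫_0^1 Σ_k c_k x^k = Σ_k c_k/(k+1)`. [cite: DavisRabinowitz1984, Sect. 2.5.4 (2.5.4.2)] -/
theorem integral_sum_mul_pow_zero_one {K : ℕ} (c : Fin K → ℝ) :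
    ∫ x in (0 : ℝ)..1, ∑ k, c k * x ^ (k : ℕ) = ∑ k, c k / ((k : ℕ) + 1) := by
  rw [intervalIntegral.integral_finsetSum fun k _ => Continuous.intervalIntegrable (by fun_prop) _ _]
  refine sum_congr rfl fun k _ => ?_
  rw [intervalIntegral.integral_const_mul, integral_pow]
  simp [div_eq_mul_inv]

/-- (2.5.4.2): `a_ij = ∫_0^1 l_i l_j` for the Simpson nodes — all nine entries; the factor is `1/30`.
[cite: DavisRabinowitz1984, Sect. 2.5.4 (2.5.4.2)] -/
theorem integral_simpsonLagrange_mul (i j : Fin 3) :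
    ∫ x in (0 : ℝ)..1, simpsonLagrange i x * simpsonLagrange j x = simpsonIPIRMatrix i j := by
  simp_rw [simpsonLagrange_mul]
  rw [integral_sum_mul_pow_zero_one]
  fin_cases i <;> fin_cases j <;> simp [simpsonLagrangeProdCoeff, simpsonIPIRMatrix, Fin.sum_univ_five] <;> norm_num

/-- The matrix is symmetric (a symmetric IPIR). [cite: DavisRabinowitz1984, Sect. 2.5.4 (2.5.4.1)] -/
theorem simpsonIPIRMatrix_symm (i j : Fin 3) : simpsonIPIRMatrix i j = simpsonIPIRMatrix j i := by
  fin_cases i <;> fin_cases j <;> simp [simpsonIPIRMatrix]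

/-- CHECK on the printed constant: the entries sum to the interval length `1` (`g = h = 1`), forcing `1/30` on
`[0, 1]`. [cite: DavisRabinowitz1984, Sect. 2.5.4 (2.5.4.2)] -/
theorem simpsonIPIRMatrix_sum : ∑ i, ∑ j, simpsonIPIRMatrix i j = 1 := by
  simp [Fin.sum_univ_three, simpsonIPIRMatrix]; norm_num

/-- … whereas the printed `(1/15)[[4, 2, −1], [2, 16, 2], [−1, 2, 4]]` sums to `2`: by (2.5.4.4) it is the matrix of
an interval of length `2` such as `[−1, 1]`. [cite: DavisRabinowitz1984, Sect. 2.5.4 (2.5.4.4)] -/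
theorem simpsonIPIRMatrix_interval_two_sum :
    ∑ i : Fin 3, ∑ j : Fin 3,
      (1 / 15 : ℝ) * (![![4, 2, -1], ![2, 16, 2], ![-1, 2, 4]] : Fin 3 → Fin 3 → ℝ) i j = 2 := by
  simp [Fin.sum_univ_three]; norm_num

/-- (2.5.4.4) for this rule: the printed matrix is `(length 2)/(length 1)` times the `[0, 1]` matrix.
[cite: DavisRabinowitz1984, Sect. 2.5.4 (2.5.4.4)] -/
theorem printedMatrix_eq_two_mul_simpsonIPIRMatrix (i j : Fin 3) :
    (1 / 15 : ℝ) * (![![4, 2, -1], ![2, 16, 2], ![-1, 2, 4]] : Fin 3 → Fin 3 → ℝ) i j =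
      2 * simpsonIPIRMatrix i j := by
  simp only [simpsonIPIRMatrix]; ring

/-! ## Exactness for joint degree (2, 2) and the non-exactness witness `π²` -/

/-- The interpolatory IPIR on the Simpson nodes is exact for all products of two quadratics (joint degree
`(2, 2)`): `gᵀ A h = ∫_0^1 g h`. [cite: DavisRabinowitz1984, Sect. 2.5.4 (2.5.4.2)] -/
theorem ipir_simpson_exact_joint22 (p₀ p₁ p₂ q₀ q₁ q₂ : ℝ) :
    ipir simpsonIPIRMatrix simpsonNodes simpsonNodes (fun x => p₀ + p₁ * x + p₂ * x ^ 2)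
        (fun x => q₀ + q₁ * x + q₂ * x ^ 2) =
      ∫ x in (0 : ℝ)..1, (p₀ + p₁ * x + p₂ * x ^ 2) * (q₀ + q₁ * x + q₂ * x ^ 2) := by
  rw [show (fun x : ℝ => (p₀ + p₁ * x + p₂ * x ^ 2) * (q₀ + q₁ * x + q₂ * x ^ 2)) =
      fun x => p₀ * q₀ + (p₀ * q₁ + p₁ * q₀) * x + (p₀ * q₂ + p₁ * q₁ + p₂ * q₀) * x ^ 2
        + (p₁ * q₂ + p₂ * q₁) * x ^ 3 + (p₂ * q₂) * x ^ 4 from funext fun x => by ring,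
    integral_quartic_zero_one]
  simp [ipir, Fin.sum_univ_three, simpsonIPIRMatrix, simpsonNodes]
  ring

/-- The node polynomial `π(x) = x(x − ½)(x − 1)`. [cite: DavisRabinowitz1984, Sect. 2.5.4 (2.5.4.3)] -/
def simpsonNodePoly (x : ℝ) : ℝ := x * (x - 1 / 2) * (x - 1)

/-- `π` vanishes at the nodes. [cite: DavisRabinowitz1984, Sect. 2.5.4 (2.5.4.3)] -/
theorem simpsonNodePoly_nodes (k : Fin 3) : simpsonNodePoly (simpsonNodes k) = 0 := by
  fin_cases k <;> simp [simpsonNodePoly, simpsonNodes]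

/-- `∫_0^1 π² = 1/840 > 0`. [cite: DavisRabinowitz1984, Sect. 2.5.4 (2.5.4.3)] -/
theorem integral_simpsonNodePoly_sq : ∫ x in (0 : ℝ)..1, simpsonNodePoly x ^ 2 = 1 / 840 := by
  have h6 : ∫ x in (0 : ℝ)..1, ∑ k : Fin 7, (![0, 0, 1 / 4, -3 / 2, 13 / 4, -3, 1] : Fin 7 → ℝ) k * x ^ (k : ℕ) =
      1 / 840 := by
    rw [integral_sum_mul_pow_zero_one]; simp [Fin.sum_univ_succ]; norm_num
  rw [← h6]
  refine intervalIntegral.integral_congr fun x _ => ?_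
  simp [simpsonNodePoly, Fin.sum_univ_succ]
  ring

/-- The book's non-exactness witness (`m = n = 2`, `l = 0`): for `g = h = π` (joint degree `(3, 3)`) every IPIR on
these nodes gives `0`, while `∫_0^1 g h = ∫ π² = 1/840 > 0`; so the Simpson-node IPIR is not exact for joint degree
`(3, 3)`. [cite: DavisRabinowitz1984, Sect. 2.5.4 (2.5.4.3)] -/
theorem ipir_simpson_not_exact_pi_sq (A : Fin 3 → Fin 3 → ℝ) :
    ipir A simpsonNodes simpsonNodes simpsonNodePoly simpsonNodePoly = 0 ∧
      ipir A simpsonNodes simpsonNodes simpsonNodePoly simpsonNodePoly ≠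
        ∫ x in (0 : ℝ)..1, simpsonNodePoly x * simpsonNodePoly x := by
  have h0 : ipir A simpsonNodes simpsonNodes simpsonNodePoly simpsonNodePoly = 0 := by
    unfold ipir
    exact sum_eq_zero fun i _ => sum_eq_zero fun j _ => by rw [simpsonNodePoly_nodes, simpsonNodePoly_nodes]; ring
  refine ⟨h0, ?_⟩
  rw [h0, show (fun x => simpsonNodePoly x * simpsonNodePoly x) = fun x => simpsonNodePoly x ^ 2 from
    funext fun x => by ring, integral_simpsonNodePoly_sq]
  norm_num

/-! ## The example of Duris: `∫_0^{2π} x sin 20x cos 50x dx = 2π/105` -/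

/-- `∫_0^{2π} x sin(kx) dx = −2π/k` for a nonzero integer `k` (integration by parts).
[cite: DavisRabinowitz1984, Sect. 2.5.4] -/
theorem integral_x_mul_sin_int {k : ℤ} (hk : k ≠ 0) :
    ∫ x in (0 : ℝ)..2 * π, x * Real.sin (k * x) = -(2 * π) / k := by
  have hk' : (k : ℝ) ≠ 0 := Int.cast_ne_zero.mpr hk
  have hv : ∀ x : ℝ, HasDerivAt (fun y : ℝ => -(1 / (k : ℝ)) * Real.cos (k * y)) (Real.sin (k * x)) x := by
    intro x
    have h1 : HasDerivAt (fun y : ℝ => (k : ℝ) * y) (k : ℝ) x := by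
      simpa using (hasDerivAt_id x).const_mul (k : ℝ)
    have h2 := ((Real.hasDerivAt_cos _).comp x h1).const_mul (-(1 / (k : ℝ)))
    refine h2.congr_deriv ?_
    field_simp
  have hc1 : IntervalIntegrable (fun _ : ℝ => (1 : ℝ)) volume 0 (2 * π) :=
    Continuous.intervalIntegrable (by fun_prop) _ _
  have hc2 : IntervalIntegrable (fun x : ℝ => Real.sin (k * x)) volume 0 (2 * π) :=
    Continuous.intervalIntegrable (by fun_prop) _ _
  have hparts := intervalIntegral.integral_mul_deriv_eq_deriv_mul (a := 0) (b := 2 * π)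
    (u := fun x : ℝ => x) (u' := fun _ => (1 : ℝ)) (fun x _ => hasDerivAt_id x) (fun x _ => hv x) hc1 hc2
  rw [hparts]
  have hcos : Real.cos (k * (2 * π)) = 1 := Real.cos_int_mul_two_pi k
  have hsin : Real.sin (k * (2 * π)) = 0 := by
    rw [show (k : ℝ) * (2 * π) = ((2 * k : ℤ) : ℝ) * π by push_cast; ring]
    exact Real.sin_int_mul_pi _
  have h1 : ∫ x in (0 : ℝ)..2 * π, Real.cos (k * x) = 0 := by
    rw [intervalIntegral.integral_comp_mul_left (fun x => Real.cos x) hk', integral_cos]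
    simp [hsin]
  have hint : ∫ x in (0 : ℝ)..2 * π, (1 : ℝ) * (-(1 / (k : ℝ)) * Real.cos (k * x)) = 0 := by
    simp only [one_mul]
    rw [intervalIntegral.integral_const_mul, h1, mul_zero]
  rw [hint, hcos]
  simp
  field_simp

/-- Product-to-sum: `x sin 20x cos 50x = (x sin 70x − x sin 30x)/2`. [cite: DavisRabinowitz1984, Sect. 2.5.4] -/
theorem x_sin_mul_cos (x : ℝ) :
    x * Real.sin (20 * x) * Real.cos (50 * x) = (x * Real.sin (70 * x) - x * Real.sin (30 * x)) / 2 := by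
  have h1 : Real.sin (70 * x) = Real.sin (20 * x) * Real.cos (50 * x) + Real.cos (20 * x) * Real.sin (50 * x) := by
    rw [show (70 : ℝ) * x = 20 * x + 50 * x by ring, Real.sin_add]
  have h2 : Real.sin (30 * x) = Real.sin (50 * x) * Real.cos (20 * x) - Real.cos (50 * x) * Real.sin (20 * x) := by
    rw [show (30 : ℝ) * x = 50 * x - 20 * x by ring, Real.sin_sub]
  rw [h1, h2]; ring

/-- Duris' integral: `I = ∫_0^{2π} x sin 20x cos 50x dx = 2π/105` (`= .05983986…`).
[cite: DavisRabinowitz1984, Sect. 2.5.4] -/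
theorem duris_integral : ∫ x in (0 : ℝ)..2 * π, x * Real.sin (20 * x) * Real.cos (50 * x) = 2 * π / 105 := by
  simp_rw [x_sin_mul_cos]
  rw [intervalIntegral.integral_div, intervalIntegral.integral_sub (Continuous.intervalIntegrable (by fun_prop) _ _)
    (Continuous.intervalIntegrable (by fun_prop) _ _)]
  have h70 := integral_x_mul_sin_int (k := 70) (by norm_num)
  have h30 := integral_x_mul_sin_int (k := 30) (by norm_num)
  push_cast at h70 h30
  rw [h70, h30]
  ring

/-- The decimal value quoted: `|2π/105 − .05983986| < 10⁻¹⁰`. [cite: DavisRabinowitz1984, Sect. 2.5.4] -/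
theorem duris_integral_decimal : |2 * π / 105 - 0.05983986| < 1e-10 := by
  have h1 := Real.pi_gt_d20
  have h2 := Real.pi_lt_d20
  rw [abs_lt]; constructor <;> linarith

end Literature.Analysis.Quadrature

end
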